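import Summits.QuantumFields.YangMills.Theorems.IR.Negative.TypShellCondFalseAllG.TreeGauge

/-!
# Crux `IR` (stmt-QuantumFields-19354) — the fixed-mesh negative for format T and the onset floor FOR EVERY COMPACT
# GAUGE GROUP, part 7/8: §11a clause (i) at the row ⇒ two-kernel bound; §11b the composition
# (sections `TwoKernel`, `Composition`)

Re-homed VERBATIM (statements, proofs, names; namespace `…Cruxes.IR.CruxIdea2g6` ↦ `…Cruxes.IR.FixedMeshAllG`) from the crux
workfile `Cruxes/IR/CruxIdea2FrameRowAllG.lean` rev 2 (sha16 81bea4c546c46a61; author `ym-cruxidea-19354-2` GEN 6) per owner R88,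
split by its sections into eight ≤ 400-line modules chained by import; credit docstring of record in the headline module
`Theorems/IR/Negative/TypShellCondFalseAllG.lean` (part 8/8).  Negative knowledge for stmt-QuantumFields-19354; closes no stub.
-/

set_option autoImplicit false

noncomputable section

open MeasureTheory Filter Topology
open Literature.MathematicalPhysics.QuantumLattice
open Literature.Probability.LatticeModels
open Summit.QuantumFields.YangMills.Cruxes.IR.Tempered (cellEdges windowCells regionEdges)
open Summit.QuantumFields.YangMills.Cruxes.IR.ShellTempered (windowCellsPlus)
open Summit.QuantumFields.YangMills.Cruxes.IR.OnsetFormats (TypShellCond shellCount)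
open Summit.QuantumFields.YangMills.Cruxes.IR.FixedMesh

namespace Summit.QuantumFields.YangMills.Cruxes.IR.FixedMeshAllG

/-! ## §11a (g5 §2, row strength) Clause (i) at the row ⇒ two-kernel bound for admissible pairs (PROVED) -/

section TwoKernel

open Literature.MathematicalPhysics.QuantumFieldTheory (wilsonMeasure GaugeConfig isProbabilityMeasure_wilsonMeasure)

variable {G : Type} [Group G] [TopologicalSpace G] [IsTopologicalGroup G] [CompactSpace G]
  [SecondCountableTopology G] [MeasurableSpace G] [BorelSpace G]
  {N : ℕ} (ρ : G →* Matrix (Fin N) (Fin N) ℂ)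

/-- **PROVED (S).** If `Typ` satisfies clause (i_T) at the standard frame, the datum `ζ` is typical TOGETHER WITH its
rim-top twist on the cells of window+shell off the row, and `u` is a cell-0 cylinder with `|u| ≤ 1`, then the row
kernels at `ζ` and at `topTwist b k ζ` give `u` means within `2ε` (single test `f = (1+u)/2`; NO charge identity is
used — the twisted kernel is NOT a gauge image of the untwisted one). -/
theorem abs_integral_sub_le_of_rowClauseI (hρ : Continuous ρ) {β : ℝ} {b n : ℕ} (hb : 1 ≤ b) {ε : ℝ}
    {Typ : (Fin 4 → ℤ) → Set (LGConfig 4 G)} (hI : RowClauseI ρ β (stdFrame b) n ε Typ)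
    (k : Site 4 → G) {u : LGConfig 4 G → ℝ} (hum : Measurable u) (hub : ∀ U, |u U| ≤ 1)
    (hucyl : IsCylinder u (cellEdges (stdFrame b) 0)) (ζ : LGConfig 4 G)
    (hζ : ∀ c' ∈ windowCellsPlus n, c' ∉ rowCells n → ζ ∈ Typ c' ∧ topTwist b k ζ ∈ Typ c') :
    |(∫ U, u U ∂(ymSpecification ρ β (rowRegion b n) ζ)) -
        ∫ U, u U ∂(ymSpecification ρ β (rowRegion b n) (topTwist b k ζ))| ≤ 2 * ε := by
  classical
  set μ := ymSpecification ρ β (rowRegion b n) ζ with hμ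
  set μ' := ymSpecification ρ β (rowRegion b n) (topTwist b k ζ) with hμ'
  haveI : IsProbabilityMeasure μ := isProbabilityMeasure_ymSpecification ρ hρ β _ ζ
  haveI : IsProbabilityMeasure μ' := isProbabilityMeasure_ymSpecification ρ hρ β _ _
  have hcyl : IsCylinder (fun U => (1 + u U) / 2) (cellEdges (stdFrame b) 0) := by
    intro x y hxy
    show (1 + u x) / 2 = (1 + u y) / 2
    rw [hucyl hxy]
  have h01 : ∀ U, 0 ≤ (1 + u U) / 2 ∧ (1 + u U) / 2 ≤ 1 := fun U => by
    have := abs_le.1 (hub U)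
    constructor <;> linarith [this.1, this.2]
  have h : |(∫ U, (1 + u U) / 2 ∂μ) - ∫ U, (1 + u U) / 2 ∂μ'| ≤ ε :=
    hI ζ (topTwist b k ζ) hζ (topTwist_agree_off_row hb k ζ) _ hcyl ((measurable_const.add hum).div_const 2) h01
  have hi : ∀ ν : Measure (LGConfig 4 G), IsProbabilityMeasure ν → Integrable u ν := fun ν _ =>
    (integrable_const (1 : ℝ)).mono' hum.aestronglyMeasurable
      (ae_of_all _ fun U => by simpa [Real.norm_eq_abs] using hub U)
  have hshift : ∀ ν : Measure (LGConfig 4 G), IsProbabilityMeasure ν →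
      ∫ U, (1 + u U) / 2 ∂ν = (1 + ∫ U, u U ∂ν) / 2 := by
    intro ν hν
    have h1 : ∫ U, (1 + u U) ∂ν = 1 + ∫ U, u U ∂ν := by
      rw [integral_add (integrable_const _) (hi ν hν)]
      simp
    simp_rw [div_eq_mul_inv]
    rw [integral_mul_const, h1]
  rw [hshift μ inferInstance, hshift μ' inferInstance] at h
  have : (1 + ∫ U, u U ∂μ) / 2 - (1 + ∫ U, u U ∂μ') / 2 = ((∫ U, u U ∂μ) - ∫ U, u U ∂μ') / 2 := by ring
  rw [this, abs_div, abs_two] at h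
  linarith

/-- The same from the tree's full clause (i_T) (g5 statement). -/
theorem abs_integral_sub_le_of_clauseI (hρ : Continuous ρ) {β : ℝ} {b n : ℕ} (hb : 1 ≤ b) {ε : ℝ}
    {Typ : (Fin 4 → ℤ) → Set (LGConfig 4 G)} (hI : ClauseI ρ β (stdFrame b) n ε Typ)
    (k : Site 4 → G) {u : LGConfig 4 G → ℝ} (hum : Measurable u) (hub : ∀ U, |u U| ≤ 1)
    (hucyl : IsCylinder u (cellEdges (stdFrame b) 0)) (ζ : LGConfig 4 G)
    (hζ : ∀ c' ∈ windowCellsPlus n, c' ∉ rowCells n → ζ ∈ Typ c' ∧ topTwist b k ζ ∈ Typ c') :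
    |(∫ U, u U ∂(ymSpecification ρ β (rowRegion b n) ζ)) -
        ∫ U, u U ∂(ymSpecification ρ β (rowRegion b n) (topTwist b k ζ))| ≤ 2 * ε :=
  abs_integral_sub_le_of_rowClauseI ρ hρ hb (rowClauseI_of_clauseI hI) k hum hub hucyl ζ hζ

end TwoKernel

/-! ## §11b The composition (PROVED; rev 2: primitive hypotheses, shaped test) -/

section Composition

open Literature.MathematicalPhysics.QuantumFieldTheory (wilsonMeasure GaugeConfig isProbabilityMeasure_wilsonMeasure)

variable {G : Type} [Group G] [TopologicalSpace G] [IsTopologicalGroup G] [CompactSpace G]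
  [SecondCountableTopology G] [MeasurableSpace G] [BorelSpace G]
  {N : ℕ} (ρ : G →* Matrix (Fin N) (Fin N) ℂ)

/-- **PROVED (properness for shaped loops).** Under the row kernel with datum `ζ` the shaped loop IS the shaped
data-adapted charged test of `ζ` (the staple is glued to `ζ`; tree `integral_ymSpecification`, `glueWith`). -/
theorem integral_comp_loopObs_eq (hρ : Continuous ρ) (β : ℝ) {b n m : ℕ} (hm : (m : ℤ) = (2 * (n : ℤ) + 1) * b)
    {ψ : ℝ → ℝ} (hψ : Continuous ψ) (ζ : LGConfig 4 G) :
    ∫ U, ψ (loopObs ρ b m U) ∂(ymSpecification ρ β (rowRegion b n) ζ) =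
      ∫ U, ψ (chargedTest ρ b m ζ U).re ∂(ymSpecification ρ β (rowRegion b n) ζ) := by
  rw [integral_ymSpecification ρ hρ β _ (F := fun U => ψ (loopObs ρ b m U))
      (hψ.measurable.comp (continuous_loopObs ρ hρ b m).measurable),
    integral_ymSpecification ρ hρ β _ (F := fun U => ψ (chargedTest ρ b m ζ U).re)
      (hψ.measurable.comp (Complex.measurable_re.comp (measurable_chargedTest ρ hρ b m ζ)))]
  congr 1
  refine integral_congr_ae (ae_of_all _ fun ζ' => ?_)
  have hst : staple b m (glueWith (rowRegion b n) ζ' ζ) = staple b m ζ :=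
    staple_eq_of_eq_off_row hm fun e he => glueWith_apply_not_mem _ _ _ he
  simp only [loopObs, chargedTest, hst]

/-- **THE FRAME-TWIST ROW — CORE (PROVED; rev 2).**  Primitive hypotheses (a fixed `β`, a measurable cell-local class
`Typ` satisfying clause (i) AT THE ROW ONLY and the single-cell torus anchor on window+shell) and a SHAPED test
`ψ ∘ Re (charged test)`, `ψ` continuous, `|ψ| ≤ 1` on `[-1, 1]`, dominated near the frozen value: `1 − ψ t ≤ A (1 − t)`
for `t ≤ 1`; INPUT T for `κ` and INPUT F for `(κ, ψ)` with value `v`; budget `2ε < 1 − v`.  Conclusion: contradiction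
beyond `β₀ = max (freezing at 1 − s²/(A+1)) (F at s)`, `s = min ((1 − v − 2ε)/4) (1/8)`. -/
theorem frame_core (hρ : Continuous ρ) (hρi : Function.Injective ρ)
    (hρu : ∀ g, ρ g ∈ Matrix.unitaryGroup (Fin N) ℂ) (hN : 1 ≤ N)
    {b : ℕ} (hb : 1 ≤ b) (n : ℕ) (κ : LGConfig 4 G → Site 4 → G)
    {ψ : ℝ → ℝ} (hψ : Continuous ψ) (hψ1 : ∀ t, |t| ≤ 1 → |ψ t| ≤ 1)
    {A : ℝ} (hA : 0 ≤ A) (hψA : ∀ t, t ≤ 1 → 1 - ψ t ≤ A * (1 - t)) {v : ℝ}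
    (hT : TopTwistTransfer ρ κ b n) (hF : FrameValueBoundObs ρ κ b n ψ v)
    {ε δ : ℝ} (hε : 2 * ε < 1 - v) (hδ0 : 0 ≤ δ) (hδ : 4 * ((windowCellsPlus n).card : ℝ) * δ < 1) :
    ∃ β₀ : ℝ, ∀ β : ℝ, β₀ ≤ β → ∀ Typ : (Fin 4 → ℤ) → Set (LGConfig 4 G),
      (∀ c, MeasurableSet (Typ c)) →
      (∀ c, DependsOn (fun σ : LGConfig 4 G => σ ∈ Typ c) ↑(cellEdges (stdFrame b) c)) →
      RowClauseI ρ β (stdFrame b) n ε Typ →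
      (∀ c ∈ windowCellsPlus n,
        (wilsonMeasure (d := 4) (L := 2 * ((2 * n + 2) * b + 1) + 1) ρ β)
          {V | torusLift (2 * ((2 * n + 2) * b + 1) + 1) V ∉ Typ c} ≤ ENNReal.ofReal δ) → False := by
  classical
  -- budgets
  set s : ℝ := min ((1 - v - 2 * ε) / 4) (1 / 8) with hs
  have hs0 : 0 < s := lt_min (by linarith) (by norm_num)
  have hs8 : s ≤ 1 / 8 := min_le_right _ _
  have hs4 : s ≤ (1 - v - 2 * ε) / 4 := min_le_left _ _
  have hA1 : 0 < A + 1 := by linarith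
  have hss : 0 < s * s / (A + 1) := div_pos (mul_pos hs0 hs0) hA1
  -- the rectangle width and the torus
  have hm : (((2 * n + 1) * b : ℕ) : ℤ) = (2 * (n : ℤ) + 1) * b := by push_cast; ring
  obtain ⟨β₁, hβ₁⟩ := torusLoopFreezing ρ hρ hρi hρu hN hb ((2 * n + 1) * b) ((2 * n + 2) * b + 1)
    (θ := 1 - s * s / (A + 1)) (by linarith)
  obtain ⟨β₂, hβ₂⟩ := hF s hs0
  refine ⟨max β₁ β₂, fun β hβ Typ hmeas hdep hI hanch' => ?_⟩
  have hβ1 : β₁ ≤ β := (le_max_left _ _).trans hβ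
  have hβ2 : β₂ ≤ β := (le_max_right _ _).trans hβ
  set L : ℕ := 2 * ((2 * n + 2) * b + 1) + 1 with hL
  set μ := wilsonMeasure (d := 4) (L := L) ρ β with hμ
  haveI : IsProbabilityMeasure μ := isProbabilityMeasure_wilsonMeasure ρ hρ β
  set Λ := rowRegion b n with hΛ
  set m : ℕ := (2 * n + 1) * b with hmdef
  set F : LGConfig 4 G → ℝ := loopObs ρ b m with hFdef
  set Fψ : LGConfig 4 G → ℝ := fun U => ψ (loopObs ρ b m U) with hFψdef
  set Ψ : GaugeConfig 4 L G → ℝ := fun V => ∫ U, F U ∂(ymSpecification ρ β Λ (torusLift L V)) with hΨ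
  set Ψψ : GaugeConfig 4 L G → ℝ := fun V => ∫ U, Fψ U ∂(ymSpecification ρ β Λ (torusLift L V)) with hΨψ
  set Ψ' : GaugeConfig 4 L G → ℝ := twistedMeanObs ρ β b n κ ψ with hΨ'
  -- INPUT T: the twisted lifts are typical too (union bound over window+shell; outer measure, no measurability needed)
  set Ac : (Fin 4 → ℤ) → Set (GaugeConfig 4 L G) := fun c => {V | torusLift L V ∉ Typ c} with hAc
  set T : (Fin 4 → ℤ) → Set (GaugeConfig 4 L G) := fun c => {V | twistΦ b κ (torusLift L V) ∉ Typ c} with hTset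
  have hμT : ∀ c ∈ windowCellsPlus n, μ (T c) ≤ ENNReal.ofReal δ := fun c hc =>
    (hT β Typ hmeas hdep c hc).trans (hanch' c hc)
  set B : Set (GaugeConfig 4 L G) := ⋃ c ∈ windowCellsPlus n, (Ac c ∪ T c) with hB
  have hμB : μ B ≤ ENNReal.ofReal (2 * ((windowCellsPlus n).card : ℝ) * δ) := by
    calc μ B ≤ ∑ c ∈ windowCellsPlus n, μ (Ac c ∪ T c) := measure_biUnion_finset_le _ _
      _ ≤ ∑ c ∈ windowCellsPlus n, (ENNReal.ofReal δ + ENNReal.ofReal δ) :=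
          Finset.sum_le_sum fun c hc =>
            (measure_union_le _ _).trans (add_le_add (hanch' c hc) (hμT c hc))
      _ = ENNReal.ofReal (2 * ((windowCellsPlus n).card : ℝ) * δ) := by
          rw [Finset.sum_const, nsmul_eq_mul, ← ENNReal.ofReal_add hδ0 hδ0, ← ENNReal.ofReal_natCast,
            ← ENNReal.ofReal_mul (Nat.cast_nonneg _)]
          congr 1
          ring
  have hgood : ∀ V ∉ B, ∀ c ∈ windowCellsPlus n, c ∉ rowCells n →
      torusLift L V ∈ Typ c ∧ twistΦ b κ (torusLift L V) ∈ Typ c := by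
    intro V hV c hc _
    simp only [hB, Set.mem_iUnion, Set.mem_union, not_exists, not_or] at hV
    have h := hV c hc
    exact ⟨of_not_not h.1, of_not_not h.2⟩
  -- §11a on the good set: `Ψψ V − Ψ' V ≤ 2ε`
  have hF1 : ∀ U, |F U| ≤ 1 := abs_loopObs_le ρ hρu b _
  have hpair : ∀ V ∉ B, Ψψ V - Ψ' V ≤ 2 * ε := by
    intro V hV
    have hprop : Ψψ V = ∫ U, ψ (chargedTest ρ b m (torusLift L V) U).re
        ∂(ymSpecification ρ β Λ (torusLift L V)) := integral_comp_loopObs_eq ρ hρ β hm hψ _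
    have h2 := abs_integral_sub_le_of_rowClauseI ρ hρ hb hI (κ (torusLift L V))
      (u := fun U => ψ (chargedTest ρ b m (torusLift L V) U).re)
      (hψ.measurable.comp (Complex.measurable_re.comp (measurable_chargedTest ρ hρ b m _)))
      (fun U => hψ1 _ ((Complex.abs_re_le_norm _).trans (norm_chargedTest_le ρ hρu b m _ U)))
      (fun x y hxy => by
        show ψ (chargedTest ρ b m (torusLift L V) x).re = ψ (chargedTest ρ b m (torusLift L V) y).re
        rw [chargedTest_isCylinder ρ hb m _ hxy])
      (torusLift L V) (hgood V hV)
    rw [hprop]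
    exact (le_abs_self _).trans h2
  -- INPUT F: the bad-value set
  set C : Set (GaugeConfig 4 L G) := {V | v + s < Ψ' V} with hC
  have hμC : μ C ≤ ENNReal.ofReal s := hβ₂ β hβ2
  -- freezing + domination + Markov: the low-shaped-loop set
  set D : Set (GaugeConfig 4 L G) := {V | s ≤ 1 - Ψψ V} with hD
  have hFψ1 : ∀ U, |Fψ U| ≤ 1 := fun U => hψ1 _ (hF1 U)
  have hΨ1 : ∀ V, |Ψ V| ≤ 1 := fun V => abs_integral_ymSpecification_le ρ hρ β Λ hF1 _
  have hΨψ1 : ∀ V, |Ψψ V| ≤ 1 := fun V => abs_integral_ymSpecification_le ρ hρ β Λ hFψ1 _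
  have hFψc : Continuous Fψ := hψ.comp (continuous_loopObs ρ hρ b _)
  have hΨm : Measurable Ψ :=
    ((continuous_integral_ymSpecification ρ hρ β Λ (continuous_loopObs ρ hρ b _) hF1).comp
      (continuous_torusLift L)).measurable
  have hΨψm : Measurable Ψψ :=
    ((continuous_integral_ymSpecification ρ hρ β Λ hFψc hFψ1).comp (continuous_torusLift L)).measurable
  have hΨi : Integrable Ψ μ :=
    (integrable_const (1 : ℝ)).mono' hΨm.aestronglyMeasurable
      (ae_of_all _ fun V => by simpa [Real.norm_eq_abs] using hΨ1 V)
  have hΨψi : Integrable Ψψ μ :=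
    (integrable_const (1 : ℝ)).mono' hΨψm.aestronglyMeasurable
      (ae_of_all _ fun V => by simpa [Real.norm_eq_abs] using hΨψ1 V)
  have h1Ψi : Integrable (fun V => 1 - Ψ V) μ := (integrable_const _).sub hΨi
  have h1Ψψi : Integrable (fun V => 1 - Ψψ V) μ := (integrable_const _).sub hΨψi
  -- pointwise domination `1 − Ψψ ≤ A (1 − Ψ)` (the shaped loop is dominated near the frozen value)
  have hdom : ∀ V, 1 - Ψψ V ≤ A * (1 - Ψ V) := by
    intro V
    haveI : IsProbabilityMeasure (ymSpecification ρ β Λ (torusLift L V)) :=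
      isProbabilityMeasure_ymSpecification ρ hρ β _ _
    have hiF : Integrable F (ymSpecification ρ β Λ (torusLift L V)) :=
      (integrable_const (1 : ℝ)).mono' (continuous_loopObs ρ hρ b _).measurable.aestronglyMeasurable
        (ae_of_all _ fun U => by simpa [Real.norm_eq_abs] using hF1 U)
    have hiFψ : Integrable Fψ (ymSpecification ρ β Λ (torusLift L V)) :=
      (integrable_const (1 : ℝ)).mono' hFψc.measurable.aestronglyMeasurable
        (ae_of_all _ fun U => by simpa [Real.norm_eq_abs] using hFψ1 U)
    have e1 : ∫ U, (1 - Fψ U) ∂(ymSpecification ρ β Λ (torusLift L V)) =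
        1 - ∫ U, Fψ U ∂(ymSpecification ρ β Λ (torusLift L V)) := by
      rw [integral_sub (integrable_const _) hiFψ, integral_const]
      simp only [Measure.real, measure_univ, ENNReal.toReal_one, smul_eq_mul, one_mul]
    have e2 : ∫ U, A * (1 - F U) ∂(ymSpecification ρ β Λ (torusLift L V)) =
        A * (1 - ∫ U, F U ∂(ymSpecification ρ β Λ (torusLift L V))) := by
      rw [integral_const_mul, integral_sub (integrable_const _) hiF, integral_const]
      simp only [Measure.real, measure_univ, ENNReal.toReal_one, smul_eq_mul, one_mul]
    have key : ∫ U, (1 - Fψ U) ∂(ymSpecification ρ β Λ (torusLift L V)) ≤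
        ∫ U, A * (1 - F U) ∂(ymSpecification ρ β Λ (torusLift L V)) :=
      integral_mono ((integrable_const _).sub hiFψ) (((integrable_const _).sub hiF).const_mul A)
        fun U => hψA _ (abs_le.1 (hF1 U)).2
    rw [e1, e2] at key
    exact key
  have hfreeze : 1 - s * s / (A + 1) ≤ ∫ V, F (torusLift L V) ∂μ := hβ₁ β hβ1
  have hDLR : ∫ V, F (torusLift L V) ∂μ = ∫ V, Ψ V ∂μ := integral_loopObs_torus ρ hρ hρu β hm
  have hE : ∫ V, (1 - Ψ V) ∂μ ≤ s * s / (A + 1) := by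
    rw [integral_sub (integrable_const _) hΨi, integral_const]
    simp only [Measure.real, measure_univ, ENNReal.toReal_one, smul_eq_mul, one_mul]
    linarith
  have hEψ : ∫ V, (1 - Ψψ V) ∂μ ≤ s * s := by
    have h3 : A * (s * s / (A + 1)) ≤ s * s := by
      rw [mul_div_assoc', div_le_iff₀ hA1]
      nlinarith [mul_pos hs0 hs0]
    calc ∫ V, (1 - Ψψ V) ∂μ ≤ ∫ V, A * (1 - Ψ V) ∂μ := integral_mono h1Ψψi (h1Ψi.const_mul A) hdom
      _ = A * ∫ V, (1 - Ψ V) ∂μ := integral_const_mul _ _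
      _ ≤ A * (s * s / (A + 1)) := mul_le_mul_of_nonneg_left hE hA
      _ ≤ s * s := h3
  have hMarkov : s * μ.real D ≤ ∫ V, (1 - Ψψ V) ∂μ :=
    mul_meas_ge_le_integral_of_nonneg (ae_of_all _ fun V => by
      have := (abs_le.1 (hΨψ1 V)).2; show (0 : ℝ) ≤ 1 - Ψψ V; linarith) h1Ψψi s
  have hμD : μ.real D ≤ s := by
    have : s * μ.real D ≤ s * s := hMarkov.trans hEψ
    exact le_of_mul_le_mul_left this hs0
  -- the three bad sets do not cover the torus
  have hμB' : μ.real B ≤ 2 * ((windowCellsPlus n).card : ℝ) * δ :=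
    ENNReal.toReal_le_of_le_ofReal (by positivity) hμB
  have hμC' : μ.real C ≤ s := ENNReal.toReal_le_of_le_ofReal hs0.le hμC
  have hcover : μ.real (B ∪ C ∪ D) < 1 := by
    calc μ.real (B ∪ C ∪ D) ≤ μ.real (B ∪ C) + μ.real D := measureReal_union_le _ _
      _ ≤ μ.real B + μ.real C + μ.real D := by
          have := measureReal_union_le (μ := μ) B C; linarith
      _ < 1 := by nlinarith
  have hex : ∃ V, V ∉ B ∪ C ∪ D := by
    by_contra hne
    push Not at hne
    have huniv : B ∪ C ∪ D = Set.univ := Set.eq_univ_of_forall hne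
    rw [huniv] at hcover
    simp [Measure.real] at hcover
  obtain ⟨V, hV⟩ := hex
  simp only [Set.mem_union, not_or] at hV
  obtain ⟨⟨hVB, hVC⟩, hVD⟩ := hV
  have h1 : Ψψ V - Ψ' V ≤ 2 * ε := hpair V hVB
  have h2 : Ψ' V ≤ v + s := not_lt.1 hVC
  have h3 : 1 - Ψψ V < s := not_le.1 hVD
  linarith

/-- **THE FRAME-TWIST ROW (composition, g5 statement; PROVED).**  For every compact `G`, every continuous faithful
unitary `ρ` of degree `N ≥ 1`, every field-dependent rim-top twist `κ` satisfying INPUT T and INPUT F with a value `r`,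
budgets `2ε < 1 − r`, `0 ≤ δ`, `4·#windowCellsPlus(n)·δ < 1`, every mesh `b ≥ 1` and window `n`:
`∃ β₀ ∀ β ≥ β₀, ¬ TypShellCond ρ β b n ε δ`  (the core with the unshaped test `ψ = id`, `A = 1`). -/
theorem not_typShellCond_frame (hρ : Continuous ρ) (hρi : Function.Injective ρ)
    (hρu : ∀ g, ρ g ∈ Matrix.unitaryGroup (Fin N) ℂ) (hN : 1 ≤ N)
    {b : ℕ} (hb : 1 ≤ b) (n : ℕ) (κ : LGConfig 4 G → Site 4 → G) {r : ℝ}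
    (hT : TopTwistTransfer ρ κ b n) (hF : FrameValueBound ρ κ b n r)
    {ε δ : ℝ} (hε : 2 * ε < 1 - r)
    (hδ0 : 0 ≤ δ) (hδ : 4 * ((windowCellsPlus n).card : ℝ) * δ < 1) :
    ∃ β₀ : ℝ, ∀ β : ℝ, β₀ ≤ β → ¬ TypShellCond ρ β b n ε δ := by
  obtain ⟨β₀, hβ₀⟩ := frame_core ρ hρ hρi hρu hN hb n κ (ψ := fun t => t) continuous_id (fun t ht => ht)
    zero_le_one (fun t _ => by linarith) hT ((frameValueBoundObs_id_iff ρ κ b n r).2 hF) hε hδ0 hδ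
  refine ⟨β₀, fun β hβ hTyp => ?_⟩
  obtain ⟨Typ, hmeas, hdep, hI, hanch⟩ := clauseI_of_typShellCond hTyp
  exact hβ₀ β hβ Typ hmeas hdep (rowClauseI_of_clauseI hI) fun c' hc' =>
    hanch ((2 * n + 2) * b + 1) (by nlinarith) c' (stdFrame_windowCellsPlus_bounds hc')

end Composition

end Summit.QuantumFields.YangMills.Cruxes.IR.FixedMeshAllG

end
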